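import Mathlib
import HarnessLib
import Summits.NavierStokesRegularity.NavierStokesRegularity.Theorems.AxisTwistDoorAveragedConeLiouvilleLidEpsilon
import Summits.NavierStokesRegularity.NavierStokesRegularity.Theorems.AxisTwistDoorAveragedConeLiouvilleLidTheoremB

/-!
# Route `AxisTwistDoor`, crux `AveragedConeLiouville` (stmt-NavierStokesRegularity-26889) — toward replacing the
# Lei–Ren input (programme R2), pieces S1 + S2 combined: THEOREM B ON THE BLOW-UP LID, unconditionally

`isParabolicNull_lidSingularSet_of_inBall` — for a suitable weak solution `(u, p)` of the unit-viscosity unforced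
Navier–Stokes system in the parabolic ball `Q_1(T, x₀)` (Albritton–Barker's class `IsSuitableWeakSolutionInBall`),
and every `R' < 1`, the set of BACKWARD-SINGULAR points of `u` on the lid `{T} × B̄(x₀, R')` (points `(T, x)` near
which `u` is unbounded on every `Q_r(T, x)`) has one-dimensional parabolic Hausdorff measure zero.  Composition of
piece S1 (`…LidEpsilon.lid_epsilon_regularity`, CKN's Proposition 2 on the lid) and piece S2
(`…LidTheoremB.isParabolicNull_lidSingularSet`, the Vitali covering argument), with the square-integrable weak gradient
of the class.  This is Caffarelli–Kohn–Nirenberg's Theorem B at the blow-up time, the partial-regularity input of R2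
on the apex lid (the interior is the tree's `ckn_partial_regularity_holds`).

Seat ns-atd-p1 (LEAD g2).  WHAT THIS IS NOT: not a statement about Navier–Stokes regularity (a property of
HYPOTHETICAL singular sets); the crux stays conditional on Lei–Ren 2024 until R2 completes.  Lands `--supports` the
crux item as a helper.
-/

noncomputable section

set_option linter.dupNamespace false

namespace Summit.NavierStokesRegularity.NavierStokesRegularity.Theorems.AveragedConeLiouville.LidPartialRegularity

open scoped ENNReal NNReal Topology
open Set Function MeasureTheory Metric Filter
open Literature.Analysis.FluidPDE
open Summit.NavierStokesRegularity.NavierStokesRegularity.Theorems.AveragedConeLiouville.LidEpsilon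
open Summit.NavierStokesRegularity.NavierStokesRegularity.Theorems.AveragedConeLiouville.LidTheoremB

/-- **Caffarelli–Kohn–Nirenberg's Theorem B on the blow-up lid.**  For `(u, p)` in Albritton–Barker's class on
`Q_1(z₀)` and `R' < 1`, the backward-singular points of `u` on the lid `{z₀.1} × B̄(z₀.2, R')` form a `𝒫¹`-null set.
[cite: CaffarelliKohnNirenberg1982, Theorem B and §6; RobinsonRodrigoSadowski2016, Thm. 16.2] -/
theorem isParabolicNull_lidSingularSet_of_inBall {z₀ : ℝ × EuclideanSpace ℝ (Fin 3)}
    {u : ℝ → EuclideanSpace ℝ (Fin 3) → EuclideanSpace ℝ (Fin 3)} {p : ℝ → EuclideanSpace ℝ (Fin 3) → ℝ}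
    (hIB : IsSuitableWeakSolutionInBall 1 z₀ u p) {R' : ℝ} (hR' : R' < 1) :
    IsParabolicNull 1 {w : ℝ × EuclideanSpace ℝ (Fin 3) |
      w.1 = z₀.1 ∧ w.2 ∈ closedBall z₀.2 R' ∧ IsBackwardSingularPoint u w} := by
  obtain ⟨ε, hε, hreg⟩ := lid_epsilon_regularity
  obtain ⟨G, hG, hGint⟩ := hIB.2.2.1
  have hGint' : ∫⁻ w in parabolicCylinder 1 ((z₀.1, z₀.2) : ℝ × EuclideanSpace ℝ (Fin 3)),
      ENNReal.ofReal (frobeniusNormSq (G w.1 w.2)) < ∞ := by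
    simpa only [Prod.mk.eta] using hGint
  exact isParabolicNull_lidSingularSet hR' hε hGint' fun x hx hlim => hreg z₀ u p G hIB hG x hx hlim

end Summit.NavierStokesRegularity.NavierStokesRegularity.Theorems.AveragedConeLiouville.LidPartialRegularity

end
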